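import Mathlib

/-!
# `DivisionGap.PerMultiplesHard` (stmt-ValiantsHypothesis-5068), line `uncharged-face-walk`:
stub `stub_fewRunsCount` — subsets of the cycle `ℤ/a` with few adjacencies

Positions `Fin a` carry the cyclic predecessor `k ↦ (finRotate a).symm k`.  For `S ⊆ Fin a` an
ADJACENCY of `S` is an element `k ∈ S` whose predecessor is also in `S`.  We prove: the number of
`d`-subsets of `Fin a` with fewer than `w` adjacencies is at most
`Σ_{w' < w} C(a, w') · C(a + 1 − (d − w'), d − w')` (truncated `ℕ`-subtraction, as written).

Proof (elementary, Mathlib only).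
* Split the count over the exact number `w' < w` of adjacencies
  (`Finset.card_eq_sum_card_fiberwise`).
* On the fibre `w'`, the map `S ↦ (F, S₀)` with `F` = the adjacencies of `S` and `S₀ = S ∖ F`
  (the run starts, transported to `Finset ℕ` along `Fin.val`) is injective (`S = F ∪ S₀`);
  `F` is a `w'`-subset of `Fin a` (`C(a, w')` choices, `Finset.card_powersetCard`), and `S₀` is a
  `(d − w')`-subset of `{0, …, a − 1}` containing no two consecutive naturals `m, m + 1`
  (if `m + 1 ∈ S₀` then its cyclic predecessor `m` is not in `S ⊇ S₀`).
* The number of `s`-subsets of `{0, …, a − 1}` with no two consecutive elements is at most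
  `C(a + 1 − s, s)` (stars and bars; here: two-step induction on `a` — either `a + 1 ∉ T`, or
  `a + 1 ∈ T` and then `a ∉ T` — closed by Pascal's rule `Nat.choose_succ_succ`).

[folklore]
-/

-- `Summit.ValiantsHypothesis.ValiantsHypothesis.…` is the tree's mandated layout (Sub = Summit).
set_option linter.dupNamespace false

noncomputable section

namespace Summit.ValiantsHypothesis.ValiantsHypothesis.Theorems.DivisionGap.PerMultiplesHard.FewRunsCount

open Finset
open scoped BigOperators

/-! ### Subsets of `{0, …, a - 1}` with no two consecutive elements -/

/-- Recursion behind the count of `(s + 1)`-subsets of `range (a + 2)` with no two consecutive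
elements: either the last point `a + 1` is absent (a subset of `range (a + 1)` of the same kind),
or it is present, hence `a` is absent, and removing `a + 1` leaves an `s`-subset of `range a` of
the same kind. -/
theorem pathIndep_succ_succ_subset (a s : ℕ) :
    (powersetCard (s + 1) (range (a + 2))).filter (fun T : Finset ℕ => ∀ k ∈ T, k + 1 ∉ T) ⊆
      (powersetCard (s + 1) (range (a + 1))).filter (fun T : Finset ℕ => ∀ k ∈ T, k + 1 ∉ T) ∪
        ((powersetCard s (range a)).filter (fun T : Finset ℕ => ∀ k ∈ T, k + 1 ∉ T)).image
          (insert (a + 1)) := by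
  intro T hT
  rw [mem_filter, mem_powersetCard] at hT
  obtain ⟨⟨hsub, hcard⟩, hind⟩ := hT
  rw [mem_union]
  by_cases h : a + 1 ∈ T
  · right
    rw [mem_image]
    refine ⟨T.erase (a + 1), ?_, insert_erase h⟩
    rw [mem_filter, mem_powersetCard]
    refine ⟨⟨?_, ?_⟩, ?_⟩
    · intro k hk
      rw [mem_erase] at hk
      have hk2 : k < a + 2 := mem_range.1 (hsub hk.2)
      have hka : k ≠ a := fun hka => hind k hk.2 (by rw [hka]; exact h)
      rw [mem_range]
      omega
    · simp [card_erase_of_mem h, hcard]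
    · intro k hk hk1
      exact hind k (mem_of_mem_erase hk) (mem_of_mem_erase hk1)
  · left
    rw [mem_filter, mem_powersetCard]
    refine ⟨⟨?_, hcard⟩, hind⟩
    intro k hk
    have hk2 : k < a + 2 := mem_range.1 (hsub hk)
    have hka : k ≠ a + 1 := fun hka => h (by rw [← hka]; exact hk)
    rw [mem_range]
    omega

/-- Pascal-type inequality for the induction step (an equality unless `a + 1 < s`, when every
term vanishes): `C(a + 1 - s, s + 1) + C(a + 1 - s, s) ≤ C(a + 2 - s, s + 1)`. -/
theorem choose_step_le (a s : ℕ) :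
    (a + 1 - s).choose (s + 1) + (a + 1 - s).choose s ≤ (a + 2 - s).choose (s + 1) := by
  rcases le_or_gt s (a + 1) with h | h
  · rw [show a + 2 - s = (a + 1 - s) + 1 by omega, Nat.choose_succ_succ, add_comm]
  · rw [show a + 1 - s = 0 by omega, show a + 2 - s = 0 by omega, Nat.choose_zero_succ,
      Nat.choose_eq_zero_of_lt (by omega : 0 < s)]

/-- The number of `s`-subsets of `{0, …, a - 1}` with no two consecutive elements is at most
`C(a + 1 - s, s)` (in fact equality holds).  Two-step induction on `a`. -/
theorem card_pathIndep_le : ∀ a s : ℕ,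
    ((powersetCard s (range a)).filter (fun T : Finset ℕ => ∀ k ∈ T, k + 1 ∉ T)).card ≤
      (a + 1 - s).choose s
  | a, 0 => by
      refine (card_filter_le _ _).trans ?_
      rw [card_powersetCard, card_range, Nat.choose_zero_right, Nat.choose_zero_right]
  | 0, s + 1 => by
      refine (card_filter_le _ _).trans ?_
      rw [card_powersetCard, card_range, Nat.choose_zero_succ]
      exact Nat.zero_le _
  | 1, s + 1 => by
      refine (card_filter_le _ _).trans ?_
      rw [card_powersetCard, card_range]
      rcases s with _ | s
      · simp
      · rw [Nat.choose_eq_zero_of_lt (by omega : 1 < s + 1 + 1)]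
        exact Nat.zero_le _
  | a + 2, s + 1 => by
      calc ((powersetCard (s + 1) (range (a + 2))).filter
              (fun T : Finset ℕ => ∀ k ∈ T, k + 1 ∉ T)).card
          ≤ ((powersetCard (s + 1) (range (a + 1))).filter
                (fun T : Finset ℕ => ∀ k ∈ T, k + 1 ∉ T) ∪
              ((powersetCard s (range a)).filter
                (fun T : Finset ℕ => ∀ k ∈ T, k + 1 ∉ T)).image (insert (a + 1))).card :=
            card_le_card (pathIndep_succ_succ_subset a s)
        _ ≤ ((powersetCard (s + 1) (range (a + 1))).filter
                (fun T : Finset ℕ => ∀ k ∈ T, k + 1 ∉ T)).card +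
              (((powersetCard s (range a)).filter
                (fun T : Finset ℕ => ∀ k ∈ T, k + 1 ∉ T)).image (insert (a + 1))).card :=
            card_union_le _ _
        _ ≤ (a + 1 + 1 - (s + 1)).choose (s + 1) + (a + 1 - s).choose s :=
            Nat.add_le_add (card_pathIndep_le (a + 1) (s + 1))
              (card_image_le.trans (card_pathIndep_le a s))
        _ ≤ _ := by
            rw [Nat.add_sub_add_right, Nat.add_sub_add_right]
            exact choose_step_le a s

/-! ### The cyclic predecessor and the fibre injection -/

/-- If `y = x + 1` as naturals (inside `Fin a`), then the cyclic predecessor of `y` is `x`. -/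
theorem finRotate_symm_eq_of_val (a : ℕ) (x y : Fin a) (h : x.val + 1 = y.val) :
    (finRotate a).symm y = x := by
  rw [Equiv.symm_apply_eq]
  cases a with
  | zero => exact x.elim0
  | succ n =>
    have hx : x.val < n := by have := y.isLt; omega
    have key : finRotate (n + 1) x = ⟨x.val + 1, by omega⟩ := finRotate_of_lt hx
    rw [key]
    exact Fin.ext h.symm

/-- The run starts `S₀ = {k ∈ S | pred k ∉ S}` of a `d`-set `S` with `w'` adjacencies, read in
`ℕ`, form a `(d - w')`-subset of `range a` with no two consecutive elements. -/
theorem runStarts_mem (a d w' : ℕ) (S : Finset (Fin a)) (hS : S.card = d)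
    (hF : (S.filter fun k => (finRotate a).symm k ∈ S).card = w') :
    (S.filter fun k => (finRotate a).symm k ∉ S).map Fin.valEmbedding ∈
      (powersetCard (d - w') (range a)).filter (fun T : Finset ℕ => ∀ m ∈ T, m + 1 ∉ T) := by
  rw [mem_filter, mem_powersetCard]
  refine ⟨⟨?_, ?_⟩, ?_⟩
  · intro m hm
    rw [mem_map] at hm
    obtain ⟨x, -, rfl⟩ := hm
    exact mem_range.2 x.isLt
  · have hsum := card_filter_add_card_filter_not (s := S) (fun k => (finRotate a).symm k ∈ S)
    rw [hF, hS] at hsum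
    rw [card_map]
    omega
  · intro m hm hm1
    rw [mem_map] at hm hm1
    obtain ⟨x, hx, rfl⟩ := hm
    obtain ⟨y, hy, hyx⟩ := hm1
    rw [mem_filter] at hx hy
    have hval : x.val + 1 = y.val := by
      simp only [Fin.valEmbedding_apply] at hyx
      omega
    exact hy.2 (finRotate_symm_eq_of_val a x y hval ▸ hx.1)

/-- A position set is recovered from its adjacencies and its run starts: the fibre map
`S ↦ (F, S₀)` is injective. -/
theorem eq_of_parts_eq (a : ℕ) (S S' : Finset (Fin a))
    (h1 : (S.filter fun k => (finRotate a).symm k ∈ S) =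
      S'.filter fun k => (finRotate a).symm k ∈ S')
    (h2 : (S.filter fun k => (finRotate a).symm k ∉ S).map Fin.valEmbedding =
      (S'.filter fun k => (finRotate a).symm k ∉ S').map Fin.valEmbedding) : S = S' := by
  rw [map_inj] at h2
  ext k
  have e1 := Finset.ext_iff.1 h1 k
  have e2 := Finset.ext_iff.1 h2 k
  simp only [mem_filter] at e1 e2
  tauto

/-- The fibre bound: the number of `d`-subsets of `Fin a` with exactly `w'` adjacencies is at most
`C(a, w') * C(a + 1 - (d - w'), d - w')`. -/
theorem card_fibre_le (a d w' : ℕ) :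
    ((Finset.univ : Finset (Finset (Fin a))).filter (fun S =>
        S.card = d ∧ (S.filter fun k => (finRotate a).symm k ∈ S).card = w')).card ≤
      a.choose w' * (a + 1 - (d - w')).choose (d - w') := by
  calc ((Finset.univ : Finset (Finset (Fin a))).filter (fun S =>
          S.card = d ∧ (S.filter fun k => (finRotate a).symm k ∈ S).card = w')).card
      ≤ (powersetCard w' (Finset.univ : Finset (Fin a)) ×ˢ
          (powersetCard (d - w') (range a)).filter
            (fun T : Finset ℕ => ∀ m ∈ T, m + 1 ∉ T)).card := by
        refine card_le_card_of_injOn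
          (fun S => ((S.filter fun k => (finRotate a).symm k ∈ S),
            (S.filter fun k => (finRotate a).symm k ∉ S).map Fin.valEmbedding)) ?_ ?_
        · intro S hS
          rw [mem_coe, mem_filter] at hS
          rw [mem_coe, mem_product]
          exact ⟨mem_powersetCard.2 ⟨subset_univ _, hS.2.2⟩, runStarts_mem a d w' S hS.2.1 hS.2.2⟩
        · intro S _ S' _ h
          simp only [Prod.mk.injEq] at h
          exact eq_of_parts_eq a S S' h.1 h.2
    _ = a.choose w' * ((powersetCard (d - w') (range a)).filter
            (fun T : Finset ℕ => ∀ m ∈ T, m + 1 ∉ T)).card := by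
        rw [card_product, card_powersetCard, card_univ, Fintype.card_fin]
    _ ≤ a.choose w' * (a + 1 - (d - w')).choose (d - w') :=
        Nat.mul_le_mul_left _ (card_pathIndep_le a (d - w'))

/-- **Registered stub `stub_fewRunsCount`.**  The number of `d`-subsets `S ⊆ Fin a` with fewer
than `w` adjacencies (elements `k ∈ S` whose cyclic predecessor `(finRotate a).symm k` is also in
`S`) is at most `Σ_{w' < w} C(a, w') · C(a + 1 − (d − w'), d − w')`. -/
theorem stub_fewRunsCount :
    ∀ (a d w : ℕ),
      ((Finset.univ : Finset (Finset (Fin a))).filter (fun S =>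
          S.card = d ∧ (S.filter fun k => (finRotate a).symm k ∈ S).card < w)).card ≤
        ∑ w' ∈ Finset.range w, a.choose w' * (a + 1 - (d - w')).choose (d - w') := by
  intro a d w
  have hmaps : Set.MapsTo
      (fun S : Finset (Fin a) => (S.filter fun k => (finRotate a).symm k ∈ S).card)
      ↑((Finset.univ : Finset (Finset (Fin a))).filter (fun S =>
          S.card = d ∧ (S.filter fun k => (finRotate a).symm k ∈ S).card < w))
      ↑(range w) := by
    intro S hS
    rw [mem_coe, mem_filter] at hS
    exact mem_coe.2 (mem_range.2 hS.2.2)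
  rw [card_eq_sum_card_fiberwise hmaps]
  refine sum_le_sum fun w' _ => le_trans (card_le_card ?_) (card_fibre_le a d w')
  intro S hS
  simp only [mem_filter, mem_univ, true_and] at hS ⊢
  exact ⟨hS.1.1, hS.2⟩

end Summit.ValiantsHypothesis.ValiantsHypothesis.Theorems.DivisionGap.PerMultiplesHard.FewRunsCount

end
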